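import Summits.CriticalPhenomena.PercolationContinuityZ3.Theorems.PercNearOneGluingNoHeavyLowerTailGluedSetExchange
import HarnessLib

/-!
# `NoHeavyLowerTail` (stmt-CriticalPhenomena-4575) — ATTACHMENT MONOTONICITY (Lemma M of the coin reduction)

Support file (prover `prim-hp-8`, PL programme / coin reduction; `--supports stmt-CriticalPhenomena-4575`).
No definitions, no named facts, no sorries.

Weights `v`, relays `A`, level `j`, `R_y = {|π(y)| ≤ j}`, an observer `o` GLUED to a vertex `c` (`v s(o,c) = 1`), `H` = the
weights with the pairs at `o` switched off.  Seen from `c`, the observer's other edges are extra edges attached at `c`.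

* `attachmentMono_glued` (deterministic weights at `o`) and `attachmentMono` (**Lemma M**, any weights at the other pairs of
  `o`): if `μ_H(R_c) ≤ μ_H(R_x)` then `μ_v(R_c) ≤ μ_v(R_x)` — attaching extra edges at `c` cannot make `c` overtake a vertex that
  was at least as light-prone as `c` before.  Proof: on `{x ↔ o}` the two blocks coincide; on `{x ↮ o}` unglue and compare in
  `H` on `{x ↮ U}` (`U` = the vertices glued to `o`), where one BHK exchange (`twoClusterExchange`, pair `(c, x)`, the type-`(−)`
  event `{x ↔ U}`) shows that removing the configurations with `x ↔ U` costs `R_c` at least as much as `R_x`.  The fractional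
  weights at `o` are removed first by affinity (as in `CoinReduction.selfGluingLoss_ge_general`).

Used by the coin reduction of the pattern-lightest bound: when the coin `o–c` is glued, every relay ranked above `c` in the
`H`-order stays at least as light-prone as `c`, so the glued branch of the one-bond expansion is nonnegative (memo
PROOF-COIN-REDUCTION.md on the item, §2).
-/

noncomputable section

namespace Summit.CriticalPhenomena.PercolationContinuityZ3.Theorems

namespace CoinReduction

open MeasureTheory Set Literature.Probability.LatticeModels Literature.Probability.Percolation
open scoped Classical

variable {n : ℕ}

open TwoClusterExchange LonelyClusterExchange in
/-- **Attachment monotonicity, deterministic weights at `o`.**  `c ≠ o`, `x ≠ o`, `v s(o,c) = 1`, every non-loop weight at `o`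
in `{0,1}`, and `μ_H(R_c) ≤ μ_H(R_x)`.  Then `μ_v(R_c) ≤ μ_v(R_x)`.
[cite: VandenbergHaggstromKahn2005, Thm. 1.5 (p. 7) — via `twoClusterExchange`] -/
theorem attachmentMono_glued (v : Sym2 (Fin n) → unitInterval) (A : Finset (Fin n)) (j : ℕ) {o c x : Fin n}
    (hco : c ≠ o) (hxo : x ≠ o) (hvc : v s(o, c) = 1)
    (hdet : ∀ y : Fin n, y ≠ o → v s(o, y) = 0 ∨ v s(o, y) = 1)
    (hle : (prodBernoulli fun e : Sym2 (Fin n) => if e ∈ {e : Sym2 (Fin n) | o ∉ e} then v e else 0).real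
        {ω : BondConfig (Fin n) | (A.filter fun z => ω ∈ openConn c z).card ≤ j} ≤
      (prodBernoulli fun e : Sym2 (Fin n) => if e ∈ {e : Sym2 (Fin n) | o ∉ e} then v e else 0).real
        {ω : BondConfig (Fin n) | (A.filter fun z => ω ∈ openConn x z).card ≤ j}) :
    (prodBernoulli v).real {ω : BondConfig (Fin n) | (A.filter fun z => ω ∈ openConn c z).card ≤ j} ≤
      (prodBernoulli v).real {ω : BondConfig (Fin n) | (A.filter fun z => ω ∈ openConn x z).card ≤ j} := by
  set μ := prodBernoulli v with hμ
  set u : Sym2 (Fin n) → unitInterval := fun e => if e ∈ {e : Sym2 (Fin n) | o ∉ e} then v e else 0 with hu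
  set Rc : Set (BondConfig (Fin n)) := {ω | (A.filter fun z => ω ∈ openConn c z).card ≤ j} with hRc
  set Rx : Set (BondConfig (Fin n)) := {ω | (A.filter fun z => ω ∈ openConn x z).card ≤ j} with hRx
  have hmeas : ∀ S : Set (BondConfig (Fin n)), MeasurableSet S := fun S => (Set.toFinite S).measurableSet
  by_cases hxc : x = c
  · subst hxc; exact le_rfl
  -- the set glued to o and the full-measure event fixing the edges at o
  set U : Finset (Fin n) := Finset.univ.filter fun y => y ≠ o ∧ v s(o, y) = 1 with hUdef
  have hoU : o ∉ U := fun h => (Finset.mem_filter.1 h).2.1 rfl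
  have hcU : c ∈ U := Finset.mem_filter.2 ⟨Finset.mem_univ _, hco, hvc⟩
  set G : Set (BondConfig (Fin n)) := {ω | ∀ y : Fin n, y ≠ o → (s(o, y) ∈ ω ↔ y ∈ U)} with hGdef
  have hGae : ∀ᵐ ω ∂μ, ω ∈ G := by
    have h : ∀ y : Fin n, ∀ᵐ ω ∂μ, y ≠ o → (s(o, y) ∈ ω ↔ y ∈ U) := by
      intro y
      by_cases hyo : y = o
      · exact Filter.Eventually.of_forall fun ω h => absurd hyo h
      rcases hdet y hyo with h0 | h1
      · have hyU : y ∉ U := by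
          intro h; have := (Finset.mem_filter.1 h).2.2; rw [h0] at this; exact zero_ne_one this
        filter_upwards [prodBernoulli_ae_notMem v h0] with ω hω
        exact fun _ => iff_of_false hω hyU
      · have hyU : y ∈ U := Finset.mem_filter.2 ⟨Finset.mem_univ _, hyo, h1⟩
        filter_upwards [prodBernoulli_ae_mem_of_eq_one v h1] with ω hω
        exact fun _ => iff_of_true hω hyU
    filter_upwards [ae_all_iff.2 h] with ω hω
    exact hω
  have hF1 : ∀ ω ∈ G, ∀ z : Fin n, z ≠ o →
      ((openGraph ω).Reachable o z ↔ ∃ y ∈ U, (openGraph (ω ∩ {e | o ∉ e})).Reachable y z) :=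
    fun ω hωG z hz => reachable_from_obs_iff' ω U hoU hωG z hz
  have hF2 : ∀ ω : BondConfig (Fin n), ∀ a b : Fin n, ¬ (openGraph ω).Reachable a o →
      ((openGraph ω).Reachable a b ↔ (openGraph (ω ∩ {e | o ∉ e})).Reachable a b) :=
    fun ω a b hao => ⟨fun h => CutObserver.reachable_avoiding_of_not_reachable hao h,
      fun h => CutObserver.reachable_mono inter_subset_left h⟩
  have hoc : ∀ ω ∈ G, (openGraph ω).Reachable o c :=
    fun ω hωG => (hF1 ω hωG c hco).2 ⟨c, hcU, SimpleGraph.Reachable.refl _⟩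
  -- split along S1 = {x ↔ o}
  set S1 : Set (BondConfig (Fin n)) := openConn x o with hS1
  have hsplit_c : μ.real Rc = μ.real (Rc ∩ S1) + μ.real (Rc \ S1) := (measureReal_inter_add_sdiff (hmeas S1)).symm
  have hsplit_x : μ.real Rx = μ.real (Rx ∩ S1) + μ.real (Rx \ S1) := (measureReal_inter_add_sdiff (hmeas S1)).symm
  -- on S1 (and G) the blocks of c and x coincide
  have h1 : μ.real (Rc ∩ S1) = μ.real (Rx ∩ S1) := by
    refine measureReal_congr (hGae.mono fun ω hωG => ?_)
    apply propext
    constructor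
    · rintro ⟨hR, hS⟩
      refine ⟨?_, hS⟩
      have hxo' : (openGraph ω).Reachable x o := hS
      have hxc' : (openGraph ω).Reachable x c := hxo'.trans (hoc ω hωG)
      simp only [hRc, hRx, mem_setOf_eq] at hR ⊢
      refine le_trans (le_of_eq (congrArg Finset.card (Finset.filter_congr fun z _ => ?_))) hR
      exact ⟨fun h => (hxc'.symm.trans h : (openGraph ω).Reachable c z),
        fun h => (hxc'.trans h : (openGraph ω).Reachable x z)⟩
    · rintro ⟨hR, hS⟩
      refine ⟨?_, hS⟩
      have hxo' : (openGraph ω).Reachable x o := hS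
      have hxc' : (openGraph ω).Reachable x c := hxo'.trans (hoc ω hωG)
      simp only [hRc, hRx, mem_setOf_eq] at hR ⊢
      refine le_trans (le_of_eq (congrArg Finset.card (Finset.filter_congr fun z _ => ?_))) hR
      exact ⟨fun h => (hxc'.trans h : (openGraph ω).Reachable x z),
        fun h => (hxc'.symm.trans h : (openGraph ω).Reachable c z)⟩
  -- the H-events
  set J : Set (BondConfig (Fin n)) := ⋃ y ∈ U, (openConn x y : Set (BondConfig (Fin n))) with hJ
  set D : Set (BondConfig (Fin n)) := (openConn c x)ᶜ with hD
  -- off S1: the c-side is at most μ_H(D ∩ Jᶜ ∩ R_c), the x-side equals μ_H(D ∩ Jᶜ ∩ R_x)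
  have hC1 : (Rc \ S1) ∩ G ⊆ {ω | ω ∩ {e | o ∉ e} ∈ D ∩ (Jᶜ ∩ Rc)} := by
    rintro ω ⟨⟨hR, hS⟩, hωG⟩
    have hnxo : ¬ (openGraph ω).Reachable x o := hS
    have hJc : ω ∩ {e | o ∉ e} ∉ J := by
      intro h
      rw [hJ, mem_iUnion₂] at h
      obtain ⟨y, hyU, hxy⟩ := h
      have hxy' : (openGraph (ω ∩ {e | o ∉ e})).Reachable x y := hxy
      exact hnxo ((hF1 ω hωG x hxo).2 ⟨y, hyU, hxy'.symm⟩).symm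
    refine ⟨?_, hJc, ?_⟩
    · intro h
      have h' : (openGraph (ω ∩ {e | o ∉ e})).Reachable c x := h
      apply hJc
      rw [hJ, mem_iUnion₂]
      exact ⟨c, hcU, (h'.symm : (openGraph (ω ∩ {e | o ∉ e})).Reachable x c)⟩
    · simp only [hRc, mem_setOf_eq] at hR ⊢
      refine le_trans (Finset.card_le_card fun z hz => ?_) hR
      simp only [Finset.mem_filter] at hz ⊢
      exact ⟨hz.1, CutObserver.reachable_mono inter_subset_left hz.2⟩
  have hC2 : ∀ ω ∈ G, ω ∈ Rx \ S1 ↔ ω ∈ {ω | ω ∩ {e | o ∉ e} ∈ D ∩ (Jᶜ ∩ Rx)} := by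
    intro ω hωG
    constructor
    · rintro ⟨hR, hS⟩
      have hnxo : ¬ (openGraph ω).Reachable x o := hS
      have hJc : ω ∩ {e | o ∉ e} ∉ J := by
        intro h
        rw [hJ, mem_iUnion₂] at h
        obtain ⟨y, hyU, hxy⟩ := h
        have hxy' : (openGraph (ω ∩ {e | o ∉ e})).Reachable x y := hxy
        exact hnxo ((hF1 ω hωG x hxo).2 ⟨y, hyU, hxy'.symm⟩).symm
      refine ⟨?_, hJc, ?_⟩
      · intro h
        have h' : (openGraph (ω ∩ {e | o ∉ e})).Reachable c x := h
        apply hJc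
        rw [hJ, mem_iUnion₂]
        exact ⟨c, hcU, (h'.symm : (openGraph (ω ∩ {e | o ∉ e})).Reachable x c)⟩
      · simp only [hRx, mem_setOf_eq] at hR ⊢
        refine le_trans (le_of_eq (congrArg Finset.card (Finset.filter_congr fun z _ => ?_))) hR
        exact (hF2 ω x z hnxo).symm
    · rintro ⟨_, hJc, hR⟩
      have hnxo : ¬ (openGraph ω).Reachable x o := by
        intro h
        obtain ⟨y, hyU, hyx⟩ := (hF1 ω hωG x hxo).1 h.symm
        apply hJc
        rw [hJ, mem_iUnion₂]
        exact ⟨y, hyU, (hyx.symm : (openGraph (ω ∩ {e | o ∉ e})).Reachable x y)⟩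
      refine ⟨?_, hnxo⟩
      simp only [hRx, mem_setOf_eq] at hR ⊢
      refine le_trans (le_of_eq (congrArg Finset.card (Finset.filter_congr fun z _ => ?_))) hR
      exact hF2 ω x z hnxo
  have hm_c : μ.real (Rc \ S1) ≤ (prodBernoulli u).real (D ∩ (Jᶜ ∩ Rc)) := by
    have e1 : μ.real (Rc \ S1) = μ.real ((Rc \ S1) ∩ G) := by
      refine measureReal_congr (hGae.mono fun ω hω => ?_)
      exact propext ⟨fun h => ⟨h, hω⟩, fun h => h.1⟩
    rw [e1, ← CutObserver.measureReal_preimage_avoid v o (D ∩ (Jᶜ ∩ Rc))]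
    exact measureReal_mono hC1 (measure_ne_top _ _)
  have hm_x : μ.real (Rx \ S1) = (prodBernoulli u).real (D ∩ (Jᶜ ∩ Rx)) := by
    rw [← CutObserver.measureReal_preimage_avoid v o (D ∩ (Jᶜ ∩ Rx))]
    refine measureReal_congr (hGae.mono fun ω hω => ?_)
    exact propext (hC2 ω hω)
  -- the BHK step in H, pair (c, x): J and R_c are of type (−), R_x of type (+)
  have hJm : ∀ ⦃ω ω' : BondConfig (Fin n)⦄, openEdgeCluster ω' c ⊆ openEdgeCluster ω c →
      openEdgeCluster ω x ⊆ openEdgeCluster ω' x → ω ∈ J → ω' ∈ J := by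
    intro ω ω' h1 h2 hω
    rw [hJ, mem_iUnion₂] at hω ⊢
    obtain ⟨y, hy, hxy⟩ := hω
    exact ⟨y, hy, typeMinus_openConn c x y h1 h2 hxy⟩
  have hRxp : ∀ ⦃ω ω' : BondConfig (Fin n)⦄, openEdgeCluster ω c ⊆ openEdgeCluster ω' c →
      openEdgeCluster ω' x ⊆ openEdgeCluster ω x → ω ∈ Rx → ω' ∈ Rx :=
    fun ω ω' h1 h2 hω => typePlus_card_le A j c x h1 h2 hω
  have hRcm : ∀ ⦃ω ω' : BondConfig (Fin n)⦄, openEdgeCluster ω' c ⊆ openEdgeCluster ω c →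
      openEdgeCluster ω x ⊆ openEdgeCluster ω' x → ω ∈ Rc → ω' ∈ Rc :=
    fun ω ω' h1 h2 hω => typeMinus_card_le A j c x h1 h2 hω
  have huniv_p : ∀ ⦃ω ω' : BondConfig (Fin n)⦄, openEdgeCluster ω c ⊆ openEdgeCluster ω' c →
      openEdgeCluster ω' x ⊆ openEdgeCluster ω x → ω ∈ (univ : Set (BondConfig (Fin n))) → ω' ∈ (univ : Set _) :=
    fun _ _ _ _ _ => mem_univ _
  have huniv_m : ∀ ⦃ω ω' : BondConfig (Fin n)⦄, openEdgeCluster ω' c ⊆ openEdgeCluster ω c →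
      openEdgeCluster ω x ⊆ openEdgeCluster ω' x → ω ∈ (univ : Set (BondConfig (Fin n))) → ω' ∈ (univ : Set _) :=
    fun _ _ _ _ _ => mem_univ _
  have hcx : c ≠ x := fun h => hxc h.symm
  -- (i) μ(D ∩ R_x ∩ J)·μ(D) ≤ μ(D ∩ R_x)·μ(D ∩ J)
  have stepi := twoClusterExchange u hcx (A₁ := Rx) (A₂ := univ) (B₁ := J) (B₂ := univ) hRxp huniv_p hJm huniv_m
  -- (ii) μ(D ∩ J)·μ(D ∩ R_c) ≤ μ(D)·μ(D ∩ J ∩ R_c)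
  have stepii := twoClusterExchange u hcx (A₁ := univ) (A₂ := univ) (B₁ := J) (B₂ := Rc) huniv_p huniv_p hJm hRcm
  simp only [inter_univ, univ_inter] at stepi stepii
  -- (iii) μ(D ∩ R_c) ≤ μ(D ∩ R_x)
  have stepiii : (prodBernoulli u).real (D ∩ Rc) ≤ (prodBernoulli u).real (D ∩ Rx) :=
    real_inter_lonely_le_of_le u A j c x hle
  set ν := prodBernoulli u with hν
  have hpm : ν.real (D ∩ J) ≤ ν.real D := measureReal_mono inter_subset_left (measure_ne_top _ _)
  have hax : ν.real (D ∩ (Jᶜ ∩ Rx)) = ν.real (D ∩ Rx) - ν.real (D ∩ (Rx ∩ J)) := by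
    have := measureReal_inter_add_sdiff (μ := ν) (s := D ∩ Rx) (hmeas J)
    have e1 : D ∩ Rx ∩ J = D ∩ (Rx ∩ J) := by ext ω; simp only [mem_inter_iff]; tauto
    have e2 : (D ∩ Rx) \ J = D ∩ (Jᶜ ∩ Rx) := by ext ω; simp only [mem_inter_iff, mem_sdiff, mem_compl_iff]; tauto
    rw [e1, e2] at this
    linarith
  have hbc : ν.real (D ∩ (Jᶜ ∩ Rc)) = ν.real (D ∩ Rc) - ν.real (D ∩ (J ∩ Rc)) := by
    have := measureReal_inter_add_sdiff (μ := ν) (s := D ∩ Rc) (hmeas J)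
    have e1 : D ∩ Rc ∩ J = D ∩ (J ∩ Rc) := by ext ω; simp only [mem_inter_iff]; tauto
    have e2 : (D ∩ Rc) \ J = D ∩ (Jᶜ ∩ Rc) := by ext ω; simp only [mem_inter_iff, mem_sdiff, mem_compl_iff]; tauto
    rw [e1, e2] at this
    linarith
  have key : ν.real (D ∩ (Jᶜ ∩ Rc)) ≤ ν.real (D ∩ (Jᶜ ∩ Rx)) := by
    rw [hax, hbc]
    by_cases hD0 : ν.real D = 0
    · have a0 : ν.real (D ∩ Rx) = 0 := le_antisymm (le_trans (measureReal_mono inter_subset_left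
        (measure_ne_top _ _)) (le_of_eq hD0)) measureReal_nonneg
      have b0 : ν.real (D ∩ Rc) = 0 := le_antisymm (le_trans (measureReal_mono inter_subset_left
        (measure_ne_top _ _)) (le_of_eq hD0)) measureReal_nonneg
      have c0 : ν.real (D ∩ (Rx ∩ J)) = 0 := le_antisymm (le_trans (measureReal_mono inter_subset_left
        (measure_ne_top _ _)) (le_of_eq hD0)) measureReal_nonneg
      have d0 : ν.real (D ∩ (J ∩ Rc)) = 0 := le_antisymm (le_trans (measureReal_mono inter_subset_left
        (measure_ne_top _ _)) (le_of_eq hD0)) measureReal_nonneg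
      rw [a0, b0, c0, d0]
    · have hDpos : 0 < ν.real D := lt_of_le_of_ne measureReal_nonneg (Ne.symm hD0)
      have hb : 0 ≤ ν.real (D ∩ Rc) := measureReal_nonneg
      have hmp : 0 ≤ ν.real D - ν.real (D ∩ J) := sub_nonneg.2 hpm
      -- m(a − ax) ≥ a(m − p), m(b − bc) ≤ b(m − p), b(m−p) ≤ a(m−p)
      have t1 : ν.real D * (ν.real (D ∩ Rx) - ν.real (D ∩ (Rx ∩ J))) ≥
          ν.real (D ∩ Rx) * (ν.real D - ν.real (D ∩ J)) := by nlinarith [stepi]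
      have t2 : ν.real D * (ν.real (D ∩ Rc) - ν.real (D ∩ (J ∩ Rc))) ≤
          ν.real (D ∩ Rc) * (ν.real D - ν.real (D ∩ J)) := by nlinarith [stepii]
      have t3 : ν.real (D ∩ Rc) * (ν.real D - ν.real (D ∩ J)) ≤
          ν.real (D ∩ Rx) * (ν.real D - ν.real (D ∩ J)) := mul_le_mul_of_nonneg_right stepiii hmp
      have t4 : ν.real D * (ν.real (D ∩ Rc) - ν.real (D ∩ (J ∩ Rc))) ≤
          ν.real D * (ν.real (D ∩ Rx) - ν.real (D ∩ (Rx ∩ J))) := by linarith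
      exact le_of_mul_le_mul_left t4 hDpos
  -- assemble
  rw [hsplit_c, hsplit_x, h1, hm_x]
  linarith [hm_c, key]

/-- **Attachment monotonicity (Lemma M).**  `c ≠ o`, `x ≠ o`, `v s(o,c) = 1` (the observer is glued onto `c`; its other
pairs carry arbitrary weights), and `μ_H(R_c) ≤ μ_H(R_x)` in the graph `H` with the pairs at `o` switched off.  Then
`μ_v(R_c) ≤ μ_v(R_x)`: gluing an observer (with all its attachments) onto `c` cannot make `c` more light-prone than a vertex that
was at least as light-prone as `c`.  Proof: `μ_v(R_x) − μ_v(R_c)` is affine in each other non-loop weight at `o`; corners by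
`attachmentMono_glued`. [folklore — via `attachmentMono_glued` (BHK 1.5)] -/
theorem attachmentMono (v : Sym2 (Fin n) → unitInterval) (A : Finset (Fin n)) (j : ℕ) {o c x : Fin n}
    (hco : c ≠ o) (hxo : x ≠ o) (hvc : v s(o, c) = 1)
    (hle : (prodBernoulli fun e : Sym2 (Fin n) => if e ∈ {e : Sym2 (Fin n) | o ∉ e} then v e else 0).real
        {ω : BondConfig (Fin n) | (A.filter fun z => ω ∈ openConn c z).card ≤ j} ≤
      (prodBernoulli fun e : Sym2 (Fin n) => if e ∈ {e : Sym2 (Fin n) | o ∉ e} then v e else 0).real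
        {ω : BondConfig (Fin n) | (A.filter fun z => ω ∈ openConn x z).card ≤ j}) :
    (prodBernoulli v).real {ω : BondConfig (Fin n) | (A.filter fun z => ω ∈ openConn c z).card ≤ j} ≤
      (prodBernoulli v).real {ω : BondConfig (Fin n) | (A.filter fun z => ω ∈ openConn x z).card ≤ j} := by
  suffices H : ∀ (k : ℕ) (v : Sym2 (Fin n) → unitInterval),
      (Finset.univ.filter fun y : Fin n => y ≠ o ∧ v s(o, y) ≠ 0 ∧ v s(o, y) ≠ 1).card = k → v s(o, c) = 1 →
      (prodBernoulli fun e : Sym2 (Fin n) => if e ∈ {e : Sym2 (Fin n) | o ∉ e} then v e else 0).real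
          {ω : BondConfig (Fin n) | (A.filter fun z => ω ∈ openConn c z).card ≤ j} ≤
        (prodBernoulli fun e : Sym2 (Fin n) => if e ∈ {e : Sym2 (Fin n) | o ∉ e} then v e else 0).real
          {ω : BondConfig (Fin n) | (A.filter fun z => ω ∈ openConn x z).card ≤ j} →
      (prodBernoulli v).real {ω : BondConfig (Fin n) | (A.filter fun z => ω ∈ openConn c z).card ≤ j} ≤
        (prodBernoulli v).real {ω : BondConfig (Fin n) | (A.filter fun z => ω ∈ openConn x z).card ≤ j} from
    H _ v rfl hvc hle
  intro k
  induction k using Nat.strong_induction_on with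
  | _ k ih =>
  intro v hk hv hlev
  set Rx : Set (BondConfig (Fin n)) := {ω | (A.filter fun z => ω ∈ openConn x z).card ≤ j} with hRx
  set Rc : Set (BondConfig (Fin n)) := {ω | (A.filter fun z => ω ∈ openConn c z).card ≤ j} with hRc
  by_cases hfrac : ∃ y : Fin n, y ≠ o ∧ v s(o, y) ≠ 0 ∧ v s(o, y) ≠ 1
  · obtain ⟨y, hyo, hy0, hy1⟩ := hfrac
    set f : Sym2 (Fin n) := s(o, y) with hf
    have hfe : f ≠ s(o, c) := by
      intro h
      apply hy1
      rw [h]; exact hv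
    have hu : ∀ t : unitInterval, (fun e : Sym2 (Fin n) => if e ∈ {e : Sym2 (Fin n) | o ∉ e} then
        Function.update v f t e else 0) =
        fun e : Sym2 (Fin n) => if e ∈ {e : Sym2 (Fin n) | o ∉ e} then v e else 0 := by
      intro t
      funext e
      by_cases he : e ∈ {e : Sym2 (Fin n) | o ∉ e}
      · have hef : e ≠ f := by
          intro h'; apply he; rw [h', hf]; exact Sym2.mem_mk_left o y
        simp only [he, if_true, Function.update_of_ne hef]
      · simp only [he, if_false]
    have hcount : ∀ t : unitInterval, (t = 0 ∨ t = 1) →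
        (Finset.univ.filter fun z : Fin n => z ≠ o ∧ Function.update v f t s(o, z) ≠ 0 ∧
          Function.update v f t s(o, z) ≠ 1).card < k := by
      intro t ht
      rw [← hk]
      apply Finset.card_lt_card
      rw [Finset.ssubset_iff_of_subset]
      · refine ⟨y, Finset.mem_filter.2 ⟨Finset.mem_univ _, hyo, hy0, hy1⟩, ?_⟩
        intro h
        have h' := (Finset.mem_filter.1 h).2.2
        rw [← hf, Function.update_self] at h'
        rcases ht with ht | ht
        · exact h'.1 ht
        · exact h'.2 ht
      · intro z hz
        have hz' := (Finset.mem_filter.1 hz).2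
        refine Finset.mem_filter.2 ⟨Finset.mem_univ _, hz'.1, ?_⟩
        by_cases hzf : s(o, z) = f
        · rw [hzf, Function.update_self] at hz'
          rcases ht with ht | ht
          · exact absurd ht hz'.2.1
          · exact absurd ht hz'.2.2
        · have h2 := hz'.2
          rwa [Function.update_of_ne hzf] at h2
    have hvt : ∀ t : unitInterval, Function.update v f t s(o, c) = 1 := by
      intro t; rw [Function.update_of_ne (Ne.symm hfe)]; exact hv
    have hlet : ∀ t : unitInterval,
        (prodBernoulli fun e : Sym2 (Fin n) => if e ∈ {e : Sym2 (Fin n) | o ∉ e} then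
            Function.update v f t e else 0).real Rc ≤
        (prodBernoulli fun e : Sym2 (Fin n) => if e ∈ {e : Sym2 (Fin n) | o ∉ e} then
            Function.update v f t e else 0).real Rx := by
      intro t; rw [hu t]; exact hlev
    have ih0 := ih _ (hcount 0 (Or.inl rfl)) (Function.update v f 0) rfl (hvt 0) (hlet 0)
    have ih1 := ih _ (hcount 1 (Or.inr rfl)) (Function.update v f 1) rfl (hvt 1) (hlet 1)
    have e1 := TieLocus.real_oneBond v f Rx
    have e2 := TieLocus.real_oneBond v f Rc
    have h0 : 0 ≤ (v f : ℝ) := (v f).2.1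
    have h1 : (v f : ℝ) ≤ 1 := (v f).2.2
    rw [e1, e2]
    nlinarith [mul_nonneg (sub_nonneg.2 h1) (sub_nonneg.2 ih0), mul_nonneg h0 (sub_nonneg.2 ih1)]
  · push Not at hfrac
    have hdet : ∀ y : Fin n, y ≠ o → v s(o, y) = 0 ∨ v s(o, y) = 1 := by
      intro y hyo
      by_cases h : v s(o, y) = 0
      · exact Or.inl h
      · exact Or.inr (hfrac y hyo h)
    exact attachmentMono_glued v A j hco hxo hv hdet hlev

end CoinReduction

end Summit.CriticalPhenomena.PercolationContinuityZ3.Theorems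

end
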